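import Summits.ABC.IUTFork.Repair.CandLana1
import Summits.ABC.IUTFork.Repair.RHSigmaSignedRemainder
import HarnessLib

/-!
# REPAIR-CATALOGUE row R-LANA (RC-130) — Project LANA's (9-1) AT CELL GRAIN: the two candidate per-cell deliverables, typed over the
# frozen `Cor312.Setting` vocabulary, with their lattice and the kernel separations (D-0123 (C); KEY RLANA, seat abc-iut-rcat-tst-9)

READING file (two reading predicates + a proved lattice; class `Lana`, rows RP-L01 / RC-130; rung LADDER-ABC:A2). HYPOTHESES, NOT
ASSERTED; typed ≠ proved; located ≠ adjudicated; refuted-as-typed ≠ refuted-in-print. TAKES NO SIDE on [IUTchIII] Cor. 3.12 /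
[IUTchIV] Thm. 1.10, on the LANA authors, or on any author; nothing here asserts abc proved or refuted. Source: Project LANA interim
report `paper:url-7e4c7f9f3efc` (bib `LANA2026Report`, a PROJECT REPORT; render of record `HOME/lit/renders/LANA-url-7e4c7f9f3efc`):
§9.2 (9-1) p. 46 l. 19–23 «we wish to show that there exists some suitable S such that η_q = η^anab_S»; §9.3 p. 46 l. 35–40 «(9-1)
indicates that the starting point η_q belongs to an orbit … generated by the indeterminacies of the formation of η^anab_S. In other
words, at the level of degree (log-volume), the rigidified q-pilot is represented in the output regions»; §10.5 p. 49 «we, the LANA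
project, do not have a proof of (9-1) at this time».

THE QUESTION (21-frontier test order 2026-08-27T06:37:54Z, verbatim core): «state (9-1) against the typed chain — what must (9-1)
deliver per (w, j) cell to give Cor 3.12? identification family already refuted on data, or genuinely weaker (Ind3-hull only)?».
GRAIN NOTE (located by abc-iut-rcat-tst-6, 07:06:47Z): (9-1) as printed is ONE equality of pilot CLASSES on one pointed real line
ℝ^ss of VOLUME CLASSES of adelic sets (p. 46 l. 1–6) — in the tree, abc-iut-w5-d182's `Repair.CandLana1.H` (= abc-iut-c312-4's
`EtaSetting.MainGoal`, `CandLana1.H_iff_mainGoal`); NO per-(w, j) clause is stated in the text. The two per-cell predicates below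
are OUR cell-grain refinements (necessary-condition probes asked for by the test order), labelled as such.

WHAT IS TYPED (cells `(i, v_ℚ)`, label `j = i+1 ∈ 𝔽_l^⋇`, packet `v_ℚ`; the catalogue's `(w, j)` = the cells over a bad place `w`):
* `CellVolId P i v_ℚ` — the IDENTIFICATION family per cell, at VOLUME level: some possible image of the Θ-pilot object in the packet
  has exactly the q-pilot image's log-volume («represented in the output regions at the level of log-volume», read packetwise).
  Over all cells this is VERBATIM abc-iut-rp-m3's row RP-M32b `Repair.CandMochizuki32.H'` (`forall_cellVolId_iff_candM32bH'`).
* `CellHullOnly P i v_ℚ` — the IND3-HULL-ONLY family per cell: `RH.SigmaLicence.cellDeficit P i v_ℚ ≤ 0` (abc-iut-rh2-q2-eq's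
  deficit = q-volume − hull-volume), i.e. the cell MARGIN `ln μ(ⁿ˚𝒰_{j,v_ℚ}) − ln μ(q_{j,v_ℚ}) ≥ 0` (`cellHullOnly_iff_margin_nonneg`)
  — the exact functional of the licence cell of record (engines A/B/C: `margin_j(w) ≥ 0`); its set-level twin is the licence cell
  `RH.SigmaLicence.licenceCells` (at the genuine bed = Σ₄, `RH.SigmaStrataEq.sigmaNu_eq_licenceCells`), which implies it
  (`cellHullOnly_of_mem_licenceCells`).
RESULTS (all PROVED, standard axioms):
(L1) `cellHullOnly_of_cellVolId` — under the bridge hypotheses identification ⟹ hull-only, CELL BY CELL (a possible image lies in the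
  hull; monotone log-volume): wherever a hull cell is refuted, the identification cell is refuted a fortiori.
(L2) `H_of_forall_cellVolId` — identification at every cell ⟹ (9-1) (`CandLana1.H_of_candM32bH'`); `statement_of_forall_cellHullOnly`
  — hull-only at every cell ⟹ the printed Statement; slice form `statementUpTo_offRemainder_of_cellHullOnlyOn` — hull-only on a
  stratum `σ` ⟹ Cor. 3.12 weakened by the off-`σ` remainder `RH.SigmaLicence.offRemainder P σ` (the MIN-SLICE shape, volume level).
(L3) WHAT (9-1) DELIVERS AT CELL GRAIN: `negLogQ_le_sumHull_of_H` — the place-and-label-SUMMED inequality `−|log(q)| ≤ (1/l⋇)·Σ_j Σ_{v_ℚ}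
  ln μ(ⁿ˚𝒰_{j,v_ℚ})` (the printed Statement; «Σ margins ≥ 0»), and NOTHING per cell: `H_not_imp_cellHullOnly` (abc-iut-w5-d232's
  `e = (2,3)` corner: (9-1) and the bridge hypotheses hold, the cell `j = 2` has deficit `+log p > 0`, `cellDeficit_expTwoThree_two`),
  `H_not_imp_forall_cellVolId` (same corner: RP-M32b fails, `CandLana1.expTwoThree_not_candM32bH'`), `forall_cellHullOnly_not_imp_H`
  (abc-iut-w4-d103's frame-flip model: the licence holds at every cell, (9-1) fails, `CandLana1.not_H_flip`), and at the pinned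
  countermodel CM both per-cell families fail (`not_forall_cellVolId_pinned`, `not_forall_cellHullOnly_pinned`).
CENSUS SENTENCE (`census`): at cell grain (9-1) is NEITHER family — strictly weaker than per-cell identification, incomparable with
per-cell hull-only; its cell-grain content is the summed margin alone; per-cell identification ⟹ per-cell hull-only ⟹ Statement.
HONEST SCOPE: the separating models are one-place `l⋇ = 2` ℚ-linear toy models of record; they model nothing of the intended
arithmetic data. [cite: LANA2026Report, §9.2 (9-1) p. 46; §9.3 p. 46]
-/

noncomputable section

open Set

namespace Summit.ABC.IUTFork.Repair.RLana91CellGrain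

open Thm311 Cor312 Cor312.Setting Cor312Vol Literature.IUT.LogThetaLattice Repair.RH.SigmaLicence

variable {T : ThetaIndex}

/-! ## 1. The two per-cell reading predicates -/

section Defs

variable {S : Situation T} (P : Cor312.Setting S)

/-- **`CellVolId` — the IDENTIFICATION family per cell, at volume level** (OUR cell-grain refinement of LANA §9.3 p. 46 «at the level
of degree (log-volume), the rigidified q-pilot is represented in the output regions», read in ONE packet `(j = i+1, v_ℚ)`): some
possible image of the Θ-pilot object at `(j, v_ℚ)` (an ⟨(Ind1) ∪ (Ind2)⟩-translate of the (Ind3)-enlarged Kummer image,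
`Cor312.Setting.possibleImages`) has mono-analytic log-volume EQUAL to that of the q-pilot image. Over all cells = row RP-M32b
`Repair.CandMochizuki32.H'`. READING PREDICATE — hypothesis, never asserted; not the located (global-line) statement (9-1).
[cite: LANA2026Report, §9.3 p. 46] -/
@[cite "LANA2026Report" "§9.3 p. 46"]
def CellVolId (i : Fin T.lstar) (vQ : T.VQ) : Prop :=
  ∃ U ∈ P.possibleImages (labelSucc i) vQ, P.qLocal (labelSucc i) vQ = (S.D P.n).logvol (labelSucc i) vQ U

/-- **`CellHullOnly` — the IND3-HULL-ONLY family per cell**: the deficit `ln μ(q_{j,v_ℚ}) − ln μ(ⁿ˚𝒰_{j,v_ℚ})` of abc-iut-rh2-q2-eq's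
`RH.SigmaLicence.cellDeficit` is `≤ 0` at the cell `(j = i+1, v_ℚ)`, i.e. the q-pilot image's log-volume is at most that of the
holomorphic hull of the union of the possible images ([IUTchIII] Cor. 3.12 Step (xi-f) p. 184, read at VOLUME level in one packet;
the catalogue's licence cell «margin_j(w) ≥ 0»). READING PREDICATE about OUR typed hull — hypothesis, never asserted.
[claim: Mochizuki2012, status: disputed] -/
@[claim "Mochizuki2012" "disputed"]
def CellHullOnly (i : Fin T.lstar) (vQ : T.VQ) : Prop :=
  cellDeficit P i vQ ≤ 0

variable {P}

/-- `CellHullOnly` unfolded: q-volume `≤` hull-volume at the cell. [folklore] -/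
theorem cellHullOnly_iff (i : Fin T.lstar) (vQ : T.VQ) :
    CellHullOnly P i vQ ↔
      P.qLocal (labelSucc i) vQ ≤ (S.D P.n).logvol (labelSucc i) vQ (P.thetaHull (labelSucc i) vQ) :=
  sub_nonpos

/-- `CellHullOnly` as the catalogue's MARGIN: `0 ≤ ln μ(ⁿ˚𝒰_{j,v_ℚ}) − ln μ(q_{j,v_ℚ})` (engines A/B/C «margin_j(w) ≥ 0»; margin =
`−cellDeficit`). [folklore] -/
theorem cellHullOnly_iff_margin_nonneg (i : Fin T.lstar) (vQ : T.VQ) :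
    CellHullOnly P i vQ ↔
      0 ≤ (S.D P.n).logvol (labelSucc i) vQ (P.thetaHull (labelSucc i) vQ) - P.qLocal (labelSucc i) vQ := by
  rw [cellHullOnly_iff, sub_nonneg]

/-! ## 2. The lattice: identification ⟹ hull-only (cellwise); licence cell ⟹ hull-only cell; hull-only ⟹ Statement -/

/-- **(L1) IDENTIFICATION ⟹ HULL-ONLY, cell by cell** (under abc-iut-c312-6's bridge hypotheses: the possible image with the q-volume
lies in the packet hull `ⁿ˚𝒰_{j,v_ℚ}`, and the log-volume is monotone on admissible regions). Hence every refutation of a hull cell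
refutes the identification cell at the same `(j, v_ℚ)`. [folklore] -/
theorem cellHullOnly_of_cellVolId (H : BridgeHyps P) {i : Fin T.lstar} {vQ : T.VQ} (h : CellVolId P i vQ) :
    CellHullOnly P i vQ := by
  obtain ⟨U, hU, hvol⟩ := h
  rw [cellHullOnly_iff, hvol]
  exact H.mono i vQ (H.image_adm i vQ _ hU) (P.thetaHull_adm (hullDefined_of_finite H i vQ))
    ((Set.subset_sUnion_of_mem hU).trans ((P.frame _ vQ).subset_hull _))

/-- The SET-level licence cell (abc-iut-rh2-q2-eq's `licenceCells`: q-region `⊆ ⁿ˚𝒰_{j,v_ℚ}`) implies the VOLUME-level cell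
(monotone log-volume). [folklore] -/
theorem cellHullOnly_of_mem_licenceCells (H : BridgeHyps P) {i : Fin T.lstar} {vQ : T.VQ}
    (h : (i, vQ) ∈ licenceCells P) : CellHullOnly P i vQ := by
  rw [cellHullOnly_iff]
  exact H.mono i vQ (P.hul_adm _ vQ _ (P.qRegion_mem _ vQ)) (P.thetaHull_adm (hullDefined_of_finite H i vQ)) h

/-- The (xi-f) `Licence` (abc-iut-c312-1) gives hull-only at every cell. [claim: Mochizuki2012, status: disputed] -/
theorem forall_cellHullOnly_of_licence (H : BridgeHyps P) (h : Thm311ToCor312.Licence P) :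
    ∀ (i : Fin T.lstar) (vQ : T.VQ), CellHullOnly P i vQ :=
  fun i vQ => cellHullOnly_of_mem_licenceCells H (h i vQ)

/-- **(L2) hull-only at EVERY cell ⟹ the printed Statement of Cor. 3.12** (sum the cell inequalities: abc-iut-rh2-q2-eq's
`statement_of_licenceOn_of_forall_deficit_nonpos` at the empty stratum). [claim: Mochizuki2012, status: disputed] -/
theorem statement_of_forall_cellHullOnly (H : BridgeHyps P) (h : ∀ (i : Fin T.lstar) (vQ : T.VQ), CellHullOnly P i vQ) :
    P.Statement :=
  statement_of_licenceOn_of_forall_deficit_nonpos H (σ := ∅) (fun t ht => absurd ht (Set.notMem_empty t))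
    fun t _ => h t.1 t.2

/-- If the deficit is `≤ 0` on a stratum `σ`, the off-`σ` remainder equals the full remainder (the cells of `σ` contribute no
positive part). [folklore] -/
theorem offRemainder_eq_offRemainder_empty_of_cellHullOnlyOn {σ : Set (Fin T.lstar × T.VQ)}
    (h : ∀ t ∈ σ, CellHullOnly P t.1 t.2) : offRemainder P σ = offRemainder P ∅ := by
  unfold offRemainder
  congr 1
  funext i
  refine finsum_congr fun vQ => ?_
  rw [Set.compl_empty, Set.indicator_of_mem (Set.mem_univ _)]
  by_cases ht : (i, vQ) ∈ σ
  · rw [Set.indicator_of_notMem (Set.notMem_compl_iff.mpr ht)]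
    exact (max_eq_right (h _ ht)).symm
  · rw [Set.indicator_of_mem (Set.mem_compl ht)]

/-- **(L2, slice form — the MIN-SLICE shape at volume level)**: hull-only on a stratum `σ` of cells ⟹ Cor. 3.12 WEAKENED by the
off-`σ` remainder `R_σ` (abc-iut-rh2-q2-eq's `StatementUpTo` / `offRemainder`). [claim: Mochizuki2012, status: disputed] -/
theorem statementUpTo_offRemainder_of_cellHullOnlyOn (H : BridgeHyps P) {σ : Set (Fin T.lstar × T.VQ)}
    (h : ∀ t ∈ σ, CellHullOnly P t.1 t.2) : StatementUpTo P (offRemainder P σ) := by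
  rw [offRemainder_eq_offRemainder_empty_of_cellHullOnlyOn h]
  exact statementUpTo_offRemainder_of_licenceOn H fun t ht => absurd ht (Set.notMem_empty t)

end Defs

/-! ## 3. Against (9-1) = `CandLana1.H`: identification everywhere ⟹ (9-1) ⟹ the summed inequality only -/

section Lattice

variable (S : LatticeSituation T) (P : Cor312.Setting S.toSituation)
  (ρ : (∀ v : T.V, v ∈ T.Vbad → Set (S.L.StarPacket v)) → ∀ (j : T.Label) (vQ : T.VQ), Set (S.L.Packet j vQ))
  (qK : ∀ v : T.V, v ∈ T.Vbad → Set (S.L.StarPacket v))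

/-- Identification at EVERY cell is, verbatim, abc-iut-rp-m3's row RP-M32b `CandMochizuki32.H'`. [folklore] -/
theorem forall_cellVolId_iff_candM32bH' :
    (∀ (i : Fin T.lstar) (vQ : T.VQ), CellVolId P i vQ) ↔ CandMochizuki32.H' S P ρ qK :=
  Iff.rfl

/-- **(L2) identification at every cell ⟹ (9-1)** (`CandLana1.H_of_candM32bH'`: packetwise equal volumes sum to equal totals).
[cite: LANA2026Report, §9.2 (9-1) p. 46] -/
theorem H_of_forall_cellVolId (h : ∀ (i : Fin T.lstar) (vQ : T.VQ), CellVolId P i vQ) : CandLana1.H S P ρ qK :=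
  CandLana1.H_of_candM32bH' S P ρ qK ((forall_cellVolId_iff_candM32bH' S P ρ qK).1 h)

/-- **(L3) WHAT (9-1) DELIVERS AT CELL GRAIN — the place-and-label-SUMMED inequality and nothing finer**: under the bridge hypotheses,
(9-1) gives `−|log(q)| ≤ (1/l⋇)·Σ_{j ∈ 𝔽_l^⋇} Σ_{v_ℚ} ln μ(ⁿ˚𝒰_{j,v_ℚ})` (the printed Statement, `CandLana1.statement_of_H`, with
`−|log(Θ)|` displayed as the real sum of the packet-hull volumes) — «the sum over all cells of the margins is `≥ 0`», the catalogue's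
tier L1b; the per-cell statements are NOT delivered (§4). [cite: LANA2026Report, §9.2 (9-1) p. 46] -/
theorem negLogQ_le_sumHull_of_H (HB : BridgeHyps P) (h : CandLana1.H S P ρ qK) :
    P.negLogQ ≤ processionNormalized fun i : Fin T.lstar =>
      ∑ᶠ vQ : T.VQ, (S.D P.n).logvol (labelSucc i) vQ (P.thetaHull (labelSucc i) vQ) := by
  obtain ⟨-, hle⟩ := CandLana1.statement_of_H S P ρ qK HB h
  rw [P.negLogTheta_eq_of_thetaFinite HB.finite, WithTop.coe_le_coe] at hle
  have hfun : (fun i : Fin T.lstar => ∑ᶠ vQ : T.VQ, (P.thetaLocal (labelSucc i) vQ).untopD 0) =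
      fun i : Fin T.lstar => ∑ᶠ vQ : T.VQ, (S.D P.n).logvol (labelSucc i) vQ (P.thetaHull (labelSucc i) vQ) := by
    funext i
    exact finsum_congr fun vQ => thetaLocal_untopD HB i vQ
  rw [hfun] at hle
  exact hle

/-- **(L3, named functional) (9-1) ⟹ the SIGNED REMAINDER is `≤ 0`**: abc-iut-rh2-q2-eq's `signedRemainder P = (1/l⋆)·Σ_j Σᶠ_{v_ℚ}
cellDeficit P (j, v_ℚ)` — all cell margins netted across labels AND places — is non-positive (`statement_iff_signedRemainder_nonpos`). This ONE
number is the whole cell-grain content of (9-1) (the catalogue's tier L1b functional «Σ margins ≥ 0»). [cite: LANA2026Report, §9.2 (9-1) p. 46] -/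
theorem signedRemainder_nonpos_of_H (HB : BridgeHyps P) (h : CandLana1.H S P ρ qK) : signedRemainder P ≤ 0 :=
  (statement_iff_signedRemainder_nonpos HB).1 (CandLana1.statement_of_H S P ρ qK HB h)

end Lattice

/-! ## 4. Kernel separations: (9-1) delivers NEITHER per-cell family; hull-only everywhere does not give (9-1); CM -/

section Separations

open Cor312.Checks Cor312.IdentifiedNonVacuity Cor312Vol.NaiveWitness Cor312Vol.PinnedWitness Cor312Vol.PinnedHonest
  Cor312Vol.GluedMonoids.Naive

variable (p : ℕ) [hp : Fact p.Prime]

/-- At abc-iut-w5-d232's corner `e = (2, 3)` (q-datum `{±q², ±q³}`, Θ-images / possible images / packet hulls all `B_{j²}`), the cell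
`j = 2` has deficit `ln μ(B_3) − ln μ(B_4) = +log p`. [folklore] -/
theorem cellDeficit_expTwoThree_two : cellDeficit (expSetting p expTwoThree) ⟨1, by decide⟩ () = Real.log p := by
  unfold cellDeficit
  rw [expSetting_qLocal_labelSucc]
  have hh : (expSetting p expTwoThree).thetaHull (labelSucc ⟨1, by decide⟩) () = pBall p (labelSucc ⟨1, by decide⟩) () 4 := by
    show (withQDatum p _ _).thetaHull _ () = _
    rw [withQDatum_thetaHull]
    rfl
  rw [hh]
  change _ - pVol p _ () (pBall p _ () 4) = _
  rw [pVol_pBall]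
  have e2 : expTwoThree ⟨labelSucc (T := Checks.toyIndex) ⟨1, by decide⟩, labelSucc_ne_zero _⟩ = 3 := if_neg (by decide)
  rw [e2]
  push_cast
  ring

/-- **(9-1) ⇏ HULL-ONLY PER CELL**: at `e = (2, 3)` the bridge hypotheses and (9-1) hold (`CandLana1.H_expTwoThree`: `−|log(q)| =
−(5/2)·log p = −|log(Θ)|`, the labels compensate, `2 + 3 = 1 + 4`) while the cell `j = 2` is NOT hull-only (deficit `+log p`).
[folklore] -/
theorem H_not_imp_cellHullOnly :
    BridgeHyps (expSetting p expTwoThree) ∧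
      CandLana1.H (naiveFull p).toLatticeSituation (expSetting p expTwoThree) (ballOfMonoid p)
        (fun v _ => qDatumExp p expTwoThree v) ∧
      ¬ CellHullOnly (expSetting p expTwoThree) ⟨1, by decide⟩ () := by
  refine ⟨expSetting_bridgeHyps p _, CandLana1.H_expTwoThree p, fun h => ?_⟩
  have h' : cellDeficit (expSetting p expTwoThree) ⟨1, by decide⟩ () ≤ 0 := h
  rw [cellDeficit_expTwoThree_two] at h'
  exact absurd h' (not_le.mpr (log_p_pos p))

/-- **(9-1) ⇏ IDENTIFICATION PER CELL**: at the same corner (9-1) holds while identification fails at the cell `j = 1` (`μ(B_2) ≠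
μ(B_1)`, the only possible image; `CandLana1.expTwoThree_not_candM32bH'`). [folklore] -/
theorem H_not_imp_forall_cellVolId :
    CandLana1.H (naiveFull p).toLatticeSituation (expSetting p expTwoThree) (ballOfMonoid p)
        (fun v _ => qDatumExp p expTwoThree v) ∧
      ¬ ∀ (i : Fin Checks.toyIndex.lstar) (vQ : Checks.toyIndex.VQ), CellVolId (expSetting p expTwoThree) i vQ :=
  ⟨CandLana1.H_expTwoThree p, fun h => CandLana1.expTwoThree_not_candM32bH' p
    ((forall_cellVolId_iff_candM32bH' (naiveFull p).toLatticeSituation (expSetting p expTwoThree) (ballOfMonoid p)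
      (fun v _ => qDatumExp p expTwoThree v)).1 h)⟩

/-- **HULL-ONLY AT EVERY CELL ⇏ (9-1)**: at abc-iut-w4-d103's frame-flip model the bridge hypotheses and the (xi-f) Licence hold
(`flip_licence`, so every cell is hull-only) while (9-1) FAILS (`CandLana1.not_H_flip`: the unique global possible image has
procession-normalised log-volume `−(5/2)·log p ≠ −log p`). [folklore] -/
theorem forall_cellHullOnly_not_imp_H :
    BridgeHyps (flipSetting p) ∧ (∀ (i : Fin Checks.toyIndex.lstar) (vQ : Checks.toyIndex.VQ), CellHullOnly (flipSetting p) i vQ) ∧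
      ¬ CandLana1.H (naiveFull p).toLatticeSituation (flipSetting p) (orbitRegion p) (qDatum p) :=
  ⟨flip_bridgeHyps p, forall_cellHullOnly_of_licence (flip_bridgeHyps p) (flip_licence p), CandLana1.not_H_flip p⟩

/-- **`signedRemainder ≤ 0` ⇏ (9-1)**: at the frame-flip model the signed remainder is `≤ 0` (the typed Corollary holds there, `flip_statement`)
while (9-1) fails — the summed functional is NECESSARY for (9-1), not sufficient. [folklore] -/
theorem signedRemainder_nonpos_not_imp_H :
    signedRemainder (flipSetting p) ≤ 0 ∧ ¬ CandLana1.H (naiveFull p).toLatticeSituation (flipSetting p) (orbitRegion p) (qDatum p) :=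
  ⟨(statement_iff_signedRemainder_nonpos (flip_bridgeHyps p)).1 (flip_statement p), CandLana1.not_H_flip p⟩

/-- At abc-iut-w4-d101's pinned countermodel CM identification does not hold at every cell (it would give (9-1), which fails there,
`CandLana1.not_H_pinned`). [folklore] -/
theorem not_forall_cellVolId_pinned :
    ¬ ∀ (i : Fin Checks.toyIndex.lstar) (vQ : Checks.toyIndex.VQ), CellVolId (pinnedSetting p) i vQ := fun h =>
  CandLana1.not_H_pinned p (H_of_forall_cellVolId (naiveFull p).toLatticeSituation (pinnedSetting p) (orbitRegion p) (qDatum p) h)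

/-- … nor hull-only at every cell (it would give the typed Corollary, which fails there, `pinnedSetting_not_statement`). [folklore] -/
theorem not_forall_cellHullOnly_pinned :
    ¬ ∀ (i : Fin Checks.toyIndex.lstar) (vQ : Checks.toyIndex.VQ), CellHullOnly (pinnedSetting p) i vQ := fun h =>
  pinnedSetting_not_statement p (statement_of_forall_cellHullOnly (pinnedSetting_bridgeHyps p) h)

/-- **CENSUS of row R-LANA at cell grain, in one term**: (lattice, any setting under the bridge hypotheses) identification-everywhere
⟹ (9-1) · identification cell ⟹ hull-only cell · hull-only everywhere ⟹ Statement; (separations, toy models of record) (9-1) ∧ ¬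
hull-only at a cell · (9-1) ∧ ¬ identification-everywhere · hull-only everywhere ∧ ¬ (9-1) · at CM neither family everywhere.
[cite: LANA2026Report, §9.2 (9-1) p. 46] -/
theorem census :
    (∀ {T : ThetaIndex} (S : LatticeSituation T) (P : Cor312.Setting S.toSituation)
        (ρ : (∀ v : T.V, v ∈ T.Vbad → Set (S.L.StarPacket v)) → ∀ (j : T.Label) (vQ : T.VQ), Set (S.L.Packet j vQ))
        (qK : ∀ v : T.V, v ∈ T.Vbad → Set (S.L.StarPacket v)),
        ((∀ (i : Fin T.lstar) (vQ : T.VQ), CellVolId P i vQ) → CandLana1.H S P ρ qK) ∧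
        (BridgeHyps P → ∀ (i : Fin T.lstar) (vQ : T.VQ), CellVolId P i vQ → CellHullOnly P i vQ) ∧
        (BridgeHyps P → (∀ (i : Fin T.lstar) (vQ : T.VQ), CellHullOnly P i vQ) → P.Statement)) ∧
      (CandLana1.H (naiveFull p).toLatticeSituation (expSetting p expTwoThree) (ballOfMonoid p)
          (fun v _ => qDatumExp p expTwoThree v) ∧
        ¬ CellHullOnly (expSetting p expTwoThree) ⟨1, by decide⟩ () ∧
        ¬ ∀ (i : Fin Checks.toyIndex.lstar) (vQ : Checks.toyIndex.VQ), CellVolId (expSetting p expTwoThree) i vQ) ∧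
      ((∀ (i : Fin Checks.toyIndex.lstar) (vQ : Checks.toyIndex.VQ), CellHullOnly (flipSetting p) i vQ) ∧
        ¬ CandLana1.H (naiveFull p).toLatticeSituation (flipSetting p) (orbitRegion p) (qDatum p)) ∧
      ((¬ ∀ (i : Fin Checks.toyIndex.lstar) (vQ : Checks.toyIndex.VQ), CellVolId (pinnedSetting p) i vQ) ∧
        ¬ ∀ (i : Fin Checks.toyIndex.lstar) (vQ : Checks.toyIndex.VQ), CellHullOnly (pinnedSetting p) i vQ) :=
  ⟨fun S P ρ qK => ⟨H_of_forall_cellVolId S P ρ qK, fun HB _ _ h => cellHullOnly_of_cellVolId HB h,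
      fun HB h => statement_of_forall_cellHullOnly HB h⟩,
    ⟨(H_not_imp_cellHullOnly p).2.1, (H_not_imp_cellHullOnly p).2.2, (H_not_imp_forall_cellVolId p).2⟩,
    ⟨(forall_cellHullOnly_not_imp_H p).2.1, (forall_cellHullOnly_not_imp_H p).2.2⟩,
    ⟨not_forall_cellVolId_pinned p, not_forall_cellHullOnly_pinned p⟩⟩

end Separations

end Summit.ABC.IUTFork.Repair.RLana91CellGrain

end
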